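import Summits.BirchSwinnertonDyer.Rank1Residual.X11b.CastellaErratumVersionOfRecord
import HarnessLib

/-!
# X11b, route R1 — END FORMS on the version of record of [Cas20]: the display assumed only under §2.5's standing hypotheses, no `p ∤ h_K` binder

HONEST FRAMING (cell `b2b-bsdres`, run/shared/lean/b2b/bsd-rank1-residual/, verbatim in every
file): the goal of the cell is to DELETE the COMBINATION-SHAPED residual classes of the
Birch–Swinnerton-Dyer formula for ALL analytic-rank `≤ 1` elliptic curves over `ℚ` — "full BSD
formula for every rank `≤ 1` curve in class `C`" assembled STRICTLY from published theorems — so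
that the rank-`≤ 1` remainder becomes exactly the CONSTRUCTION-SHAPED classes, which are TYPED
(missing-input `Prop`s), NOT attempted. This is not "finishing BSD". Sub-cell
`b2b-bsdres-multr1-p1` (X11b, route R1); no claim beyond the stated class; X11b stays
CONSTRUCTION-SHAPED; nothing here changes a label; no named fact (theorems only; no `sorry`).

Companion of `CastellaErratumVersionOfRecord.lean` (query Q7: `p ∤ h_K` is absent from the
version of record of [Cas20]; what §2.5 carries — odd `−D_K < −3`, `p > 2` split, (heeg) at the
tame level `N_E/p` prime to `p` — is the predicate `Cas20Standing`, a THEOREM on every erratum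
field at an odd `q`, `IsErratumField.cas20Standing`). Here: route R1's end forms with the open
input (A) assumed ONLY over erratum fields satisfying `Cas20Standing K p (N_E/p)` — "(A|VoR)",
exactly where the congruence (c) = [Cas20, Thm. 2.11] is printed — and with NO class-number binder
(referee nit `Cas20-hK-binder-superfluous`, R100.4/R100.6):

* `display_oddDisc_of_display_versionOfRecord` — (A|VoR) ⟹ (A|odd `d_K`) of p210941: the new open
  input is WEAKER (assumed on fewer fields), so the theorems below are STRONGER than gen 6's;
* `bsdp_of_display_versionOfRecord` — per pair, GIVEN an erratum field for an odd `q`: EIGHT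
  published named facts + (A|VoR) ⟹ `BSD(E,p)` (p210941's `bsdp_of_display_hK` with the `p ∤ h_K`
  binder deleted);
* **`forall_bsdp_of_display_versionOfRecord`** — class level on `ChainLocus ∩ {an odd non-split
  ramified q}`: NINE published named facts (Friedberg–Hoffstein supplying the field) + (A|VoR);
  `forall_bsdp_of_display_versionOfRecord'` re-derives it from p210941 by bookkeeping;
* **`bsdp_of_display_versionOfRecord_of_witnesses`** — data level: the census columns on `(E, p)`
  (`5 ≤ p`, Mult, Irr, non-split ∨ `p ∤ v_p Δ`, odd non-split `q` with `p ∤ v_q Δ`, a third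
  multiplicative `ℓ` with `p ∤ v_ℓ Δ`, `r_an = 1`) + NINE published facts + (A|VoR) — supersedes
  gen 6's `bsdp_of_display_hK_of_witnesses` (p212767): no `p ∤ h_K`, no field input.

END STATE of route R1 (bookkeeping; labels unchanged; nothing booked): on `ChainLocus ∩ {an odd
non-split ramified q}` (`90.9 %` of the `ChainLocus` census `N < 5·10⁵`): `BSD(E,p)` ⇐ NINE PUB
facts + (A|VoR) [OPEN: the display (5.3) at data with `p ∤ c` over erratum fields meeting
[Cas20, §2.5] ⇐ erratum Thm. 1.1 ⇐ [FW21, Thm. 4.41] (PREPRINT) + Hida theory (a), (b) + (c) =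
[Cas20, Thm. 2.11] INSIDE its printed hypotheses]. CONDITIONAL; deletes nothing.

References: [Castella2020JIMJ] §2.5 (author PDF p. 8), Thm. 2.11 (p. 12); [Castella2018Erratum]
Thm. 1.1, Thm. A′, proof of Thm. 1.1 (p. 4) (c); [Castella2018] §5; [FriedbergHoffstein1995] Thm. B.
-/

noncomputable section

open scoped Classical

open WeierstrassCurve NumberField Literature.NumberTheory.EllipticCurves
  Literature.NumberTheory.EllipticCurves.ModularForms
  Literature.NumberTheory.EllipticCurves.Rank1Residual

namespace Summit.BirchSwinnertonDyer.Rank1Residual.X11b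

/-! ### The end forms with the display restricted to the version of record's hypotheses, no `h_K` -/

section EndForm

/-- **(A|VoR) ⟹ (A|odd `d_K`)**: the display (5.3) assumed only over erratum fields meeting
[Cas20, §2.5]'s standing hypotheses at `N_E/p` (the new, WEAKER open input) yields the display
over all odd-discriminant erratum fields (the open input of p210941's
`forall_bsdp_of_display_oddDisc`), because those hypotheses are theorems there
(`IsErratumField.cas20Standing`; `q ≠ 2` from `2 ∤ d_K`, `IsErratumField.not_two_dvd_discr_iff`).
Bookkeeping; nothing asserted about (A). [cite: Castella2020JIMJ, §2.5 (author PDF p. 8)] -/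
theorem display_oddDisc_of_display_versionOfRecord
    (hA : ∀ (W : WeierstrassCurve ℚ) [W.IsElliptic] [W.IsGloballyMinimal] [NeZero (W.conductorNorm ℤ)]
        (p : ℕ) [Fact p.Prime] (q : ℕ) [Fact q.Prime] (K : Type) [Field K] [NumberField K]
        (Dt : ModularParametrizationData W (W.conductorNorm ℤ))
        (H : HeegnerDatum (W.conductorNorm ℤ) (NumberField.discr K)) (ι : K →+* ℂ)
        (P : (W.baseChange K).toAffine.Point),
        ErratumHypotheses W p → W.analyticRank = 1 → q ≠ p → Mult W q →
        ¬ W.HasSplitMultiplicativeReductionAtPrime q → ¬ p ∣ padicValInt q W.minimalDiscriminantInt →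
        IsErratumField W K q → Cas20Standing K p (W.conductorNorm ℤ / p) →
        WeierstrassCurve.Affine.Point.map ι.toRatAlgHom P = heegnerPointComplex Dt H →
        ¬ (p : ℤ) ∣ Dt.c → ¬ IsOfFinAddOrder P → Display53At W p K P) :
    ∀ (W : WeierstrassCurve ℚ) [W.IsElliptic] [W.IsGloballyMinimal] [NeZero (W.conductorNorm ℤ)]
        (p : ℕ) [Fact p.Prime] (q : ℕ) [Fact q.Prime] (K : Type) [Field K] [NumberField K]
        (Dt : ModularParametrizationData W (W.conductorNorm ℤ))
        (H : HeegnerDatum (W.conductorNorm ℤ) (NumberField.discr K)) (ι : K →+* ℂ)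
        (P : (W.baseChange K).toAffine.Point),
        ErratumHypotheses W p → W.analyticRank = 1 → q ≠ p → Mult W q →
        ¬ W.HasSplitMultiplicativeReductionAtPrime q → ¬ p ∣ padicValInt q W.minimalDiscriminantInt →
        IsErratumField W K q → ¬ (2 : ℤ) ∣ NumberField.discr K →
        WeierstrassCurve.Affine.Point.map ι.toRatAlgHom P = heegnerPointComplex Dt H →
        ¬ (p : ℤ) ∣ Dt.c → ¬ IsOfFinAddOrder P → Display53At W p K P := by
  intro W _ _ _ p _ q _ K _ _ Dt H ι P hE hr hqp hmq hnsq hvq hKf hodd hP hc hnt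
  exact hA W p q K Dt H ι P hE hr hqp hmq hnsq hvq hKf
    (hKf.cas20Standing hE hqp ((hKf.not_two_dvd_discr_iff).mp hodd) hmq) hP hc hnt

/-- **Per pair, with a GIVEN field, no class-number binder: `BSD(E,p)` on `ChainLocus` at an odd
non-split ramified `q` from EIGHT published named facts and the open input (A|VoR).** Inputs: `hGZ`
(Gross–Zagier I.7.3), `hGZK` (Gross–Zagier–Kolyvagin over `ℚ`), `hSk` (Skinner 2016 Thm. C), `hmod`
(modularity), `hCST` (Cai–Shu–Tian 2014 Thm. 1.1), `hMaz` (Mazur 1978 Cor. 4.1), `hNS` (Néron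
mapping property) — PUBLISHED —; `hA` = (A|VoR) — OPEN: the display (5.3) at data with `p ∤ c`
over erratum fields satisfying [Cas20, §2.5]'s standing hypotheses at the tame level `N_E/p` —;
the pair on `ChainLocus` with `ord_{s=1}L(E,s) = 1`; an ODD prime `q ≠ p` of non-split
multiplicative reduction with `p ∤ v_q(Δ)`; an erratum field `K` for `q` (it meets §2.5,
`IsErratumField.cas20Standing`). Proof = the body of p210941's `bsdp_of_display_hK` with the
`p ∤ h_K` binder deleted. CONDITIONAL on (A|VoR); deletes nothing; X11b stays CONSTRUCTION-SHAPED.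
[cite: Castella2018, §5 (arXiv:1704.06608 p. 12)] [cite: Castella2018Erratum, Thm. 1.1, Thm. A′ and proof of Thm. 1.1 (p. 4) (c)]
[cite: Castella2020JIMJ, §2.5 (author PDF p. 8) and Thm. 2.11 (p. 12)] -/
theorem bsdp_of_display_versionOfRecord
    (hGZ : GrossZagier1986_thm_I_7_3) (hGZK : rank_eq_analyticRank_of_analyticRank_le_one)
    (hSk : Skinner2016.thmC_padicValRat_bsd_rank_zero) (hmod : exists_isNewformOf)
    (hCST : CaiShuTian2014.thm11_trivialChar)
    (hMaz : mazur_not_dvd_maninConstant_of_odd) (hNS : integral_neronScaling_of_isGloballyMinimal)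
    (hA : ∀ (W : WeierstrassCurve ℚ) [W.IsElliptic] [W.IsGloballyMinimal] [NeZero (W.conductorNorm ℤ)]
        (p : ℕ) [Fact p.Prime] (q : ℕ) [Fact q.Prime] (K : Type) [Field K] [NumberField K]
        (Dt : ModularParametrizationData W (W.conductorNorm ℤ))
        (H : HeegnerDatum (W.conductorNorm ℤ) (NumberField.discr K)) (ι : K →+* ℂ)
        (P : (W.baseChange K).toAffine.Point),
        ErratumHypotheses W p → W.analyticRank = 1 → q ≠ p → Mult W q →
        ¬ W.HasSplitMultiplicativeReductionAtPrime q → ¬ p ∣ padicValInt q W.minimalDiscriminantInt →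
        IsErratumField W K q → Cas20Standing K p (W.conductorNorm ℤ / p) →
        WeierstrassCurve.Affine.Point.map ι.toRatAlgHom P = heegnerPointComplex Dt H →
        ¬ (p : ℤ) ∣ Dt.c → ¬ IsOfFinAddOrder P → Display53At W p K P)
    (W : WeierstrassCurve ℚ) [W.IsElliptic] [W.IsGloballyMinimal] (p : ℕ) [Fact p.Prime]
    (hCL : ChainLocus W p) (hr : W.analyticRank = 1)
    (q : ℕ) [Fact q.Prime] (hq2 : q ≠ 2) (hqp : q ≠ p) (hmq : Mult W q)
    (hnsq : ¬ W.HasSplitMultiplicativeReductionAtPrime q)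
    (hvq : ¬ p ∣ padicValInt q W.minimalDiscriminantInt)
    (K : Type) [Field K] [NumberField K] (hKf : IsErratumField W K q) :
    BSDp W p := by
  have hE : ErratumHypotheses W p := hCL.erratumHypotheses
  haveI : NeZero (W.conductorNorm ℤ) := ⟨(W.conductorNorm_pos_holds).ne'⟩
  have hmodE : hasEntireLFunction_rat := hasEntireLFunction_rat_of_exists_isNewformOf hmod
  -- a second ramified multiplicative prime `ℓ ∉ {p, q}` from `ChainLocus`
  obtain ⟨ℓ, hℓF, hℓp, hℓq, hmℓ, hvℓ⟩ : ∃ (ℓ : ℕ) (_ : Fact ℓ.Prime), ℓ ≠ p ∧ ℓ ≠ q ∧ Mult W ℓ ∧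
      ¬ p ∣ padicValInt ℓ W.minimalDiscriminantInt := by
    obtain ⟨⟨q₀, hq₀F, ℓ₀, hℓ₀F, hq₀p, hℓ₀p, hℓ₀q₀, hmq₀, -, hvq₀, hmℓ₀, hvℓ₀⟩, -⟩ := hCL.2.2.2
    by_cases h : q₀ = q
    · subst h
      exact ⟨ℓ₀, hℓ₀F, hℓ₀p, hℓ₀q₀, hmℓ₀, hvℓ₀⟩
    · exact ⟨q₀, hq₀F, hq₀p, h, hmq₀, hvq₀⟩
  -- the version of record's standing hypotheses hold on `K`
  have hVoR : Cas20Standing K p (W.conductorNorm ℤ / p) := hKf.cas20Standing hE hqp hq2 hmq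
  -- a datum with Manin constant prime to `p`, its Heegner point
  obtain ⟨Dt, hc⟩ := maninPackage_of_neronScaling hmod hMaz hNS W p hE hr
  obtain ⟨H, ι, P, hP, hnt⟩ :=
    heegnerDatumSupply_of_caiShuTian W hmodE
      (CaiShuTian2014.exists_isHeegnerPoint_of_heegnerCondition_of_modularity
        (nonempty_modularParametrizationData_iff_exists_isNewformOf_unconditional.mpr hmod))
      CaiShuTian2014.exists_map_eq_heegnerPointComplex_of_heegnerCondition_holds hCST hr hmq hnsq
      hKf Dt
  -- a globally minimal model of the twist and the transports
  have hd0 : (NumberField.discr K : ℚ) ≠ 0 := by exact_mod_cast NumberField.discr_ne_zero K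
  haveI := W.isElliptic_quadraticTwist hd0
  obtain ⟨C, hCmin⟩ := hasGlobalMinimalModel_rat_holds (W.quadraticTwist (NumberField.discr K : ℚ))
  set Wd := C • W.quadraticTwist (NumberField.discr K : ℚ) with hWd_def
  haveI : Wd.IsGloballyMinimal := hCmin
  have hWd : ∃ C' : VariableChange ℚ, C' • W.quadraticTwist (NumberField.discr K : ℚ) = Wd :=
    ⟨C, rfl⟩
  obtain ⟨htm, hti, htr⟩ := twistTransportAt_of_twist W p hKf.1 Wd hWd
  have hsp : SplitsIn K p := hKf.splitsIn_of_mult hE.2.1 (Ne.symm hqp)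
  have hsℓ : SplitsIn K ℓ := hKf.splitsIn_of_mult hmℓ hℓq
  have hmultd : Mult Wd p := htm hsp hE.2.1
  have hirrd : Irr Wd p := hti hE.2.2.1
  obtain ⟨hmℓd, hvℓd⟩ := htr ℓ hℓp hsℓ hmℓ hvℓ
  have hLd : Wd.entireLFunction 1 ≠ 0 := by
    rw [hWd_def, WeierstrassCurve.entireLFunction_smul]
    exact hKf.2.2.2.2
  -- links (A|VoR) [input], (B), (C) [tree theorems] and the bookkeeping
  exact bsdp_of_links W p hGZ hGZK hSk hE.1 hE.2.2.1 hr K hKf.1 Wd hWd hLd hmultd hirrd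
    ⟨ℓ, hℓF, hℓp, hmℓd, hvℓd⟩ P
    (hA W p q K Dt H ι P hE hr hqp hmq hnsq hvq hKf hVoR hP hc hnt)
    (gzParaphraseAt_of_datum W p hE.1 hGZK hmodE hCST hr hE.2.2.1 hmq hnsq hKf hsp Dt H ι P hP hc
      hnt Wd (Cd := C) rfl)
    (tamagawaDescentAt_of_isErratumField W p hE.1 q hmq hvq K hKf Wd hWd)

/-- **Class level — the PRINT-FAITHFUL end form of route R1 after Q7: `BSD(E,p)` for every
rank-one pair on `ChainLocus` having an odd non-split ramified multiplicative `q`, from NINE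
published named facts + (A|VoR) [OPEN], with NO class-number binder and NO field supply beyond
Friedberg–Hoffstein.** Inputs: `hGZ`, `hGZK`, `hSk`, `hmod`, `hCST`, `hFH` (Friedberg–Hoffstein
1995 Thm. B, special case: the erratum field), `hMaz`, `hNS` — PUBLISHED —; `hA` = (A|VoR): the
display (5.3) at data with `p ∤ c` over erratum fields meeting [Cas20, §2.5] (odd `−D_K < −3`,
`p > 2` split, (heeg) at `N_E/p` prime to `p`) — OPEN ⇐ erratum Thm. 1.1 ⇐ [FW21, Thm. 4.41]
(PREPRINT) + (a), (b), (c) = [Cas20, Thm. 2.11] INSIDE its printed hypotheses. Equals p210941's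
`forall_bsdp_of_display_oddDisc` composed with `display_oddDisc_of_display_versionOfRecord`.
CONDITIONAL; deletes nothing; X11b stays CONSTRUCTION-SHAPED; the `q = 2` corner of `ChainLocus`
remains outside (c)'s "odd discriminant". [cite: Castella2018Erratum, Thm. 1.1 and proof (p. 4) (c)]
[cite: Castella2020JIMJ, §2.5 (author PDF p. 8) and Thm. 2.11 (p. 12)] [cite: FriedbergHoffstein1995, Thm. B (special case)] -/
theorem forall_bsdp_of_display_versionOfRecord
    (hGZ : GrossZagier1986_thm_I_7_3) (hGZK : rank_eq_analyticRank_of_analyticRank_le_one)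
    (hSk : Skinner2016.thmC_padicValRat_bsd_rank_zero) (hmod : exists_isNewformOf)
    (hCST : CaiShuTian2014.thm11_trivialChar)
    (hFH : friedbergHoffstein_exists_twist_ne_zero_ramifiedAt)
    (hMaz : mazur_not_dvd_maninConstant_of_odd) (hNS : integral_neronScaling_of_isGloballyMinimal)
    (hA : ∀ (W : WeierstrassCurve ℚ) [W.IsElliptic] [W.IsGloballyMinimal] [NeZero (W.conductorNorm ℤ)]
        (p : ℕ) [Fact p.Prime] (q : ℕ) [Fact q.Prime] (K : Type) [Field K] [NumberField K]
        (Dt : ModularParametrizationData W (W.conductorNorm ℤ))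
        (H : HeegnerDatum (W.conductorNorm ℤ) (NumberField.discr K)) (ι : K →+* ℂ)
        (P : (W.baseChange K).toAffine.Point),
        ErratumHypotheses W p → W.analyticRank = 1 → q ≠ p → Mult W q →
        ¬ W.HasSplitMultiplicativeReductionAtPrime q → ¬ p ∣ padicValInt q W.minimalDiscriminantInt →
        IsErratumField W K q → Cas20Standing K p (W.conductorNorm ℤ / p) →
        WeierstrassCurve.Affine.Point.map ι.toRatAlgHom P = heegnerPointComplex Dt H →
        ¬ (p : ℤ) ∣ Dt.c → ¬ IsOfFinAddOrder P → Display53At W p K P) :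
    ∀ (W : WeierstrassCurve ℚ) [W.IsElliptic] [W.IsGloballyMinimal] (p : ℕ) [Fact p.Prime],
      ChainLocus W p →
      (∃ (q : ℕ) (_ : Fact q.Prime), q ≠ 2 ∧ q ≠ p ∧ Mult W q ∧
        ¬ W.HasSplitMultiplicativeReductionAtPrime q ∧ ¬ p ∣ padicValInt q W.minimalDiscriminantInt) →
      W.analyticRank = 1 → BSDp W p := by
  intro W _ _ p _ hCL ⟨q, hqF, hq2, hqp, hmq, hnsq, hvq⟩ hr
  obtain ⟨K, _, _, hKf⟩ := erratumField_supply hmod hFH W p q hr hmq hnsq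
  exact bsdp_of_display_versionOfRecord hGZ hGZK hSk hmod hCST hMaz hNS hA W p hCL hr q hq2 hqp hmq
    hnsq hvq K hKf

/-- The same theorem obtained by pure bookkeeping from p210941: `forall_bsdp_of_display_oddDisc`
∘ `display_oddDisc_of_display_versionOfRecord` (a consistency check of the two proofs). [folklore] -/
theorem forall_bsdp_of_display_versionOfRecord'
    (hGZ : GrossZagier1986_thm_I_7_3) (hGZK : rank_eq_analyticRank_of_analyticRank_le_one)
    (hSk : Skinner2016.thmC_padicValRat_bsd_rank_zero) (hmod : exists_isNewformOf)
    (hCST : CaiShuTian2014.thm11_trivialChar)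
    (hFH : friedbergHoffstein_exists_twist_ne_zero_ramifiedAt)
    (hMaz : mazur_not_dvd_maninConstant_of_odd) (hNS : integral_neronScaling_of_isGloballyMinimal)
    (hA : ∀ (W : WeierstrassCurve ℚ) [W.IsElliptic] [W.IsGloballyMinimal] [NeZero (W.conductorNorm ℤ)]
        (p : ℕ) [Fact p.Prime] (q : ℕ) [Fact q.Prime] (K : Type) [Field K] [NumberField K]
        (Dt : ModularParametrizationData W (W.conductorNorm ℤ))
        (H : HeegnerDatum (W.conductorNorm ℤ) (NumberField.discr K)) (ι : K →+* ℂ)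
        (P : (W.baseChange K).toAffine.Point),
        ErratumHypotheses W p → W.analyticRank = 1 → q ≠ p → Mult W q →
        ¬ W.HasSplitMultiplicativeReductionAtPrime q → ¬ p ∣ padicValInt q W.minimalDiscriminantInt →
        IsErratumField W K q → Cas20Standing K p (W.conductorNorm ℤ / p) →
        WeierstrassCurve.Affine.Point.map ι.toRatAlgHom P = heegnerPointComplex Dt H →
        ¬ (p : ℤ) ∣ Dt.c → ¬ IsOfFinAddOrder P → Display53At W p K P) :
    ∀ (W : WeierstrassCurve ℚ) [W.IsElliptic] [W.IsGloballyMinimal] (p : ℕ) [Fact p.Prime],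
      ChainLocus W p →
      (∃ (q : ℕ) (_ : Fact q.Prime), q ≠ 2 ∧ q ≠ p ∧ Mult W q ∧
        ¬ W.HasSplitMultiplicativeReductionAtPrime q ∧ ¬ p ∣ padicValInt q W.minimalDiscriminantInt) →
      W.analyticRank = 1 → BSDp W p :=
  forall_bsdp_of_display_oddDisc hGZ hGZK hSk hmod hCST hFH hMaz hNS
    (display_oddDisc_of_display_versionOfRecord hA)

/-- **Data level — route R1's end form on census columns only, no field input, no class-number
binder.** For `W/ℚ` globally minimal elliptic with `ord_{s=1}L(E,s) = 1` and a prime `p ≥ 5` of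
multiplicative reduction with `E[p]` irreducible, whose reduction is non-split or has
`p ∤ v_p(Δ_min)`; an ODD prime `q ≠ p` of non-split multiplicative reduction with `p ∤ v_q(Δ_min)`
and a further multiplicative `ℓ ∉ {p, q}` with `p ∤ v_ℓ(Δ_min)` (all decidable from Cremona-type
data: the columns of `census500k/census2.py`); the NINE published named facts `hGZ hGZK hSk hmod
hCST hFH hMaz hNS`; and the OPEN input (A|VoR): `BSD(E,p)`. Supersedes gen 6's
`bsdp_of_display_hK_of_witnesses` (p212767), whose `p ∤ h_K` binder and given-field input are gone
(`chainLocus_of_witnesses` + `forall_bsdp_of_display_versionOfRecord`). CONDITIONAL on (A|VoR);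
deletes nothing; X11b stays CONSTRUCTION-SHAPED.
[cite: Castella2018Erratum, Thm. 1.1 and Thm. A′ (p. 1), Remark (p. 2)] [cite: Castella2018, §5 (arXiv:1704.06608 p. 12)]
[cite: Castella2020JIMJ, §2.5 (author PDF p. 8) and Thm. 2.11 (p. 12)] -/
theorem bsdp_of_display_versionOfRecord_of_witnesses
    (hGZ : GrossZagier1986_thm_I_7_3) (hGZK : rank_eq_analyticRank_of_analyticRank_le_one)
    (hSk : Skinner2016.thmC_padicValRat_bsd_rank_zero) (hmod : exists_isNewformOf)
    (hCST : CaiShuTian2014.thm11_trivialChar)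
    (hFH : friedbergHoffstein_exists_twist_ne_zero_ramifiedAt)
    (hMaz : mazur_not_dvd_maninConstant_of_odd) (hNS : integral_neronScaling_of_isGloballyMinimal)
    (hA : ∀ (W : WeierstrassCurve ℚ) [W.IsElliptic] [W.IsGloballyMinimal] [NeZero (W.conductorNorm ℤ)]
        (p : ℕ) [Fact p.Prime] (q : ℕ) [Fact q.Prime] (K : Type) [Field K] [NumberField K]
        (Dt : ModularParametrizationData W (W.conductorNorm ℤ))
        (H : HeegnerDatum (W.conductorNorm ℤ) (NumberField.discr K)) (ι : K →+* ℂ)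
        (P : (W.baseChange K).toAffine.Point),
        ErratumHypotheses W p → W.analyticRank = 1 → q ≠ p → Mult W q →
        ¬ W.HasSplitMultiplicativeReductionAtPrime q → ¬ p ∣ padicValInt q W.minimalDiscriminantInt →
        IsErratumField W K q → Cas20Standing K p (W.conductorNorm ℤ / p) →
        WeierstrassCurve.Affine.Point.map ι.toRatAlgHom P = heegnerPointComplex Dt H →
        ¬ (p : ℤ) ∣ Dt.c → ¬ IsOfFinAddOrder P → Display53At W p K P)
    (W : WeierstrassCurve ℚ) [W.IsElliptic] [W.IsGloballyMinimal] (p : ℕ) [Fact p.Prime]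
    (hp : 5 ≤ p) (hmult : Mult W p) (hirr : Irr W p)
    (hloc : ¬ W.HasSplitMultiplicativeReductionAtPrime p ∨ ¬ p ∣ padicValInt p W.minimalDiscriminantInt)
    (hr : W.analyticRank = 1)
    {q : ℕ} [Fact q.Prime] {ℓ : ℕ} [Fact ℓ.Prime] (hq2 : q ≠ 2) (hqp : q ≠ p) (hℓp : ℓ ≠ p)
    (hℓq : ℓ ≠ q) (hmq : Mult W q) (hnsq : ¬ W.HasSplitMultiplicativeReductionAtPrime q)
    (hvq : ¬ p ∣ padicValInt q W.minimalDiscriminantInt)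
    (hmℓ : Mult W ℓ) (hvℓ : ¬ p ∣ padicValInt ℓ W.minimalDiscriminantInt) :
    BSDp W p :=
  forall_bsdp_of_display_versionOfRecord hGZ hGZK hSk hmod hCST hFH hMaz hNS hA W p
    (chainLocus_of_witnesses W p hp hmult hirr hloc hqp hℓp hℓq hmq hnsq hvq hmℓ hvℓ)
    ⟨q, ‹_›, hq2, hqp, hmq, hnsq, hvq⟩ hr

end EndForm

end Summit.BirchSwinnertonDyer.Rank1Residual.X11b

end
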